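import Summits.Ventures.CertifiedManyBodySolver.Observables.PhaseSeparationExclusionBoxThermalHotAnchor
import Literature.MathematicalPhysics.QuantumLattice.HubbardTTPrimePhaseCoexistenceExclusionGrandCanonical
import HarnessLib

/-!
# Ventures/CertifiedManyBodySolver — Observables/PhaseSeparationExclusionBoxGrandCanonical.lean: the competing-orders word on a
# `(t′, U)` CELL of a material box, READ ON THE CHEMICAL-POTENTIAL AXIS — no `μ` carries grand-canonical states of both excluded
# densities, and a CELL-UNIFORM certified chemical-potential gap; `T = 0` and `T > 0` (hot anchors); fns / columns / above-column forms

HONEST FRAMING: first certified bounds; not a superconductivity verdict. CLASS = TRANSPORT (generic, sorry-free theorems; no claim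
node, no number): the grand-canonical twin of `PhaseSeparationExclusionBox` (`T = 0`) and `PhaseSeparationExclusionBoxThermalHotAnchor`
(`T > 0`). Same cell inputs (cap affine in `U`, two column laws at `n₂`, a floor function at `n₁`, cell-uniform pressure anchors),
conclusions about the grand-canonical states of `H(t, s, U) − μN` at every `(s, U)` of the cell, through the laws of
`Literature/…/HubbardTTPrimePhaseCoexistenceExclusionGrandCanonical.lean` (this seat, g22):
* §1 `T = 0` (translation-invariant mean-energy minimisers of ANY `Γ` with `e_Γ = e_{Φ(t,s,U)} − μρ`, e.g. `hubbardTTPrimeMuInteraction t s U μ`):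
  `psGC_gap_on_cell_of_fns` (a cell-uniform margin `g ≤ aF₁ + bF₂ − C` is a cell-uniform gap `a·b·(n₂−n₁)·(μ₂ − μ₁) ≥ g` between any `μ₁`
  carrying a ground state of density `≤ n₁` and any `μ₂` carrying one of density `≥ n₂`), `psGC_gap_on_cell_of_columns` (COLUMN FORM: `g` below
  the two column margins at every `s` suffices — the margin is affine in `U`), `psGC_gap_above_column` (cap non-decreasing in `U`, one law,
  far-end margin); and the one-`μ` exclusions `psGC_not_groundState_on_cell_of_columns` / `…_above_column` («no `μ` carries both»).
* §2 `T > 0` (variational equilibria `IsVarEquilibrium β Γ`, hot anchors, threshold `β ≥ β₀`): `psGCT_not_equilibrium_on_cell_of_fns_hotAnchor`,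
  `…_of_columns_hotAnchor`, `…_above_column_hotAnchor` — hypotheses IDENTICAL to the canonical thermal forms, conclusion «at `(β; t, s, U; μ)` no
  equilibrium of density `≥ n₂` coexists with one of density `≤ n₁`».
Cell `pub/hubbard-downfold` (MO-S1 ↔ S2 seam «box ↦ one word», filling direction = Legendre pair `μ ↔ n`), seat `hubbard-downfold-unc-2` (g22).
Instances: `Downfold/BoxesLa214V115M2cPhaseSeparationGrandCanonical.lean` (LSCO `x = 1/8` box).
NOT said: anything outside the cells; which phase is realised; an ESTIMATE of `μ(n)` (the gap is a floor); stripes / SC / `T_c`.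
References: [cite: Israel1979, Thm. I.2.4]; [cite: Ruelle1969, §3.4]; [cite: EmeryKivelsonLin1990, pp. 475–476]; [cite: Griffiths1966, §II];
[cite: PoulinHastings2011, eqs. (3)–(8)].
-/

noncomputable section

namespace Summit.Ventures.CertifiedManyBodySolver.Observables

open Literature.MathematicalPhysics.QuantumLattice Literature.MathematicalPhysics.QuantumLattice.ThermodynamicLimit
open Literature.MathematicalPhysics.QuantumLattice.InfVolFermionState Set Filter

/-- The margin at `(s, U)` with the `U`-chord floor is the `U`-chord of the two column margins (everything is affine in `U`). [folklore] -/
private theorem margin_uchord_identity {a b c₀ c₁ U₁ U₂ U F L₁ L₂ : ℝ} (h12 : U₁ < U₂) :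
    a * F + b * (((U₂ - U) * L₁ + (U - U₁) * L₂) / (U₂ - U₁)) - (c₀ + c₁ * U) =
      ((U₂ - U) * (a * F + b * L₁ - (c₀ + c₁ * U₁)) + (U - U₁) * (a * F + b * L₂ - (c₀ + c₁ * U₂))) / (U₂ - U₁) := by
  have hd : (U₂ - U₁) ≠ 0 := (sub_pos.2 h12).ne'
  field_simp
  ring

/-! ## §1 `T = 0`: grand-canonical ground states of `H(t, s, U) − μN` on a cell -/

/-- **CELL-UNIFORM CHEMICAL-POTENTIAL GAP from three bound functions (`T = 0`).** Cell `[s₁, s₂] × [U₁, U₂]` (`U₁ ≥ 0`), densities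
`0 < n₁ < n₂ < 2`, weights `a, b ≥ 0`, `a + b = 1`; a cap function `C` at `an₁ + bn₂`, floor functions `F₁, F₂` at `n₁, n₂`, valid on the cell,
and a cell-uniform margin `g ≤ aF₁ + bF₂ − C`. Then at every `(s, U)` of the cell: if `μ₁` carries a translation-invariant ground state of
`H(t,s,U) − μ₁N` (any `Γ₁` with `e_{Γ₁} = e_Φ − μ₁ρ`) of density `≤ n₁` and `μ₂` one of density `≥ n₂`, then `a·b·(n₂ − n₁)·(μ₂ − μ₁) ≥ g`.
[cite: Israel1979, Thm. I.2.4] [cite: EmeryKivelsonLin1990, pp. 475–476] -/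
theorem psGC_gap_on_cell_of_fns (t : ℝ) {s₁ s₂ U₁ U₂ n₁ n₂ a b g : ℝ} (hU₁ : 0 ≤ U₁) (hn₁ : 0 < n₁) (hn : n₁ < n₂)
    (hn₂ : n₂ < 2) (ha : 0 ≤ a) (hb : 0 ≤ b) (hab : a + b = 1) {C F₁ F₂ : ℝ → ℝ → ℝ}
    (hC : ∀ s ∈ Icc s₁ s₂, ∀ U ∈ Icc U₁ U₂, energyDensityTT' t s U (a * n₁ + b * n₂) ≤ C s U)
    (hF₁ : ∀ s ∈ Icc s₁ s₂, ∀ U ∈ Icc U₁ U₂, F₁ s U ≤ energyDensityTT' t s U n₁)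
    (hF₂ : ∀ s ∈ Icc s₁ s₂, ∀ U ∈ Icc U₁ U₂, F₂ s U ≤ energyDensityTT' t s U n₂)
    (hg : ∀ s ∈ Icc s₁ s₂, ∀ U ∈ Icc U₁ U₂, g ≤ a * F₁ s U + b * F₂ s U - C s U)
    {s : ℝ} (hs : s ∈ Icc s₁ s₂) {U : ℝ} (hU : U ∈ Icc U₁ U₂)
    {Γ₁ Γ₂ : FermionInteraction 2} {R₁ R₂ μ₁ μ₂ : ℝ} {ω₁ ω₂ : InfVolFermionState 2}
    (hω₁ : ω₁.IsMeanEnergyMinimiser Γ₁ R₁)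
    (hΓ₁ : ∀ σ : InfVolFermionState 2, σ.meanEnergy Γ₁ R₁ = σ.meanEnergy (hubbardTTPrimeFermionInteraction t s U) 1 - μ₁ * σ.density)
    (hω₂ : ω₂.IsMeanEnergyMinimiser Γ₂ R₂)
    (hΓ₂ : ∀ σ : InfVolFermionState 2, σ.meanEnergy Γ₂ R₂ = σ.meanEnergy (hubbardTTPrimeFermionInteraction t s U) 1 - μ₂ * σ.density)
    (hρ₁ : ω₁.density ≤ n₁) (hρ₂ : n₂ ≤ ω₂.density) :
    g ≤ a * b * (n₂ - n₁) * (μ₂ - μ₁) := by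
  have h := margin_le_mul_sub_chemPot_of_groundStates_ttPrime t s (hU₁.trans hU.1) hω₁ hΓ₁ hω₂ hΓ₂ hn₁ hn₂ hρ₁ hn.le hρ₂ ha hb hab
    (hC s hs U hU) (hF₁ s hs U hU) (hF₂ s hs U hU)
  linarith [hg s hs U hU]

/-- **CELL-UNIFORM GAP, COLUMN FORM (`T = 0`).** A cap `e(t, s, U, an₁ + bn₂) ≤ c₀ + c₁U` on the cell, two COLUMN LAWS
`L_i(s) ≤ e(t, s, U_i, n₂)` (their `U`-chord floors the cell), a floor function `F₁(s) ≤ e(t, s, U, n₁)` on the cell, and `g` below BOTH column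
margins at every `s`: `g ≤ aF₁(s) + bL_i(s) − (c₀ + c₁U_i)`. Then the gap `a·b·(n₂ − n₁)·(μ₂ − μ₁) ≥ g` of `psGC_gap_on_cell_of_fns` holds at every
`(s, U)` of the cell. [cite: Israel1979, Thm. I.2.4] [cite: Ruelle1969, §3.4] -/
theorem psGC_gap_on_cell_of_columns (t : ℝ) {s₁ s₂ U₁ U₂ n₁ n₂ a b c₀ c₁ g : ℝ} (hU₁ : 0 ≤ U₁) (h12 : U₁ < U₂)
    (hn₁ : 0 < n₁) (hn : n₁ < n₂) (hn₂ : n₂ < 2) (ha : 0 ≤ a) (hb : 0 ≤ b) (hab : a + b = 1) {L₁ L₂ F₁ : ℝ → ℝ}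
    (hC : ∀ s ∈ Icc s₁ s₂, ∀ U ∈ Icc U₁ U₂, energyDensityTT' t s U (a * n₁ + b * n₂) ≤ c₀ + c₁ * U)
    (hL₁ : ∀ s ∈ Icc s₁ s₂, L₁ s ≤ energyDensityTT' t s U₁ n₂) (hL₂ : ∀ s ∈ Icc s₁ s₂, L₂ s ≤ energyDensityTT' t s U₂ n₂)
    (hF₁ : ∀ s ∈ Icc s₁ s₂, ∀ U ∈ Icc U₁ U₂, F₁ s ≤ energyDensityTT' t s U n₁)
    (hg₁ : ∀ s ∈ Icc s₁ s₂, g ≤ a * F₁ s + b * L₁ s - (c₀ + c₁ * U₁))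
    (hg₂ : ∀ s ∈ Icc s₁ s₂, g ≤ a * F₁ s + b * L₂ s - (c₀ + c₁ * U₂))
    {s : ℝ} (hs : s ∈ Icc s₁ s₂) {U : ℝ} (hU : U ∈ Icc U₁ U₂)
    {Γ₁ Γ₂ : FermionInteraction 2} {R₁ R₂ μ₁ μ₂ : ℝ} {ω₁ ω₂ : InfVolFermionState 2}
    (hω₁ : ω₁.IsMeanEnergyMinimiser Γ₁ R₁)
    (hΓ₁ : ∀ σ : InfVolFermionState 2, σ.meanEnergy Γ₁ R₁ = σ.meanEnergy (hubbardTTPrimeFermionInteraction t s U) 1 - μ₁ * σ.density)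
    (hω₂ : ω₂.IsMeanEnergyMinimiser Γ₂ R₂)
    (hΓ₂ : ∀ σ : InfVolFermionState 2, σ.meanEnergy Γ₂ R₂ = σ.meanEnergy (hubbardTTPrimeFermionInteraction t s U) 1 - μ₂ * σ.density)
    (hρ₁ : ω₁.density ≤ n₁) (hρ₂ : n₂ ≤ ω₂.density) :
    g ≤ a * b * (n₂ - n₁) * (μ₂ - μ₁) := by
  refine psGC_gap_on_cell_of_fns t hU₁ hn₁ hn hn₂ ha hb hab (C := fun _ U => c₀ + c₁ * U) (F₁ := fun s _ => F₁ s)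
    (F₂ := fun s U => ((U₂ - U) * L₁ s + (U - U₁) * L₂ s) / (U₂ - U₁)) hC hF₁
    (floor_on_cell_of_columnLaws t (hn₁.le.trans hn.le) hn₂ hU₁ h12 hL₁ hL₂) ?_ hs hU hω₁ hΓ₁ hω₂ hΓ₂ hρ₁ hρ₂
  intro s hs U hU
  have hge := chord_ge_of_ends_ge h12 hU (hg₁ s hs) (hg₂ s hs)
  have hid := margin_uchord_identity (a := a) (b := b) (c₀ := c₀) (c₁ := c₁) (U := U) (F := F₁ s) (L₁ := L₁ s) (L₂ := L₂ s) h12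
  show g ≤ a * F₁ s + b * (((U₂ - U) * L₁ s + (U - U₁) * L₂ s) / (U₂ - U₁)) - (c₀ + c₁ * U)
  rw [hid]
  exact hge

/-- **CELL-UNIFORM GAP ABOVE A COLUMN (`T = 0`).** For `U ∈ [U₂, U₃]` (`U₂ ≥ 0`): a cap `e(t, s, U, an₁ + bn₂) ≤ c₀ + c₁U` with `c₁ ≥ 0`,
ONE column law `L(s) ≤ e(t, s, U₂, n₂)` (it floors every `U ≥ U₂`, Griffiths), a floor function `F₁(s)` on the cell, and `g` below the
FAR-END margin `aF₁(s) + bL(s) − (c₀ + c₁U₃)` for every `s`: the gap `a·b·(n₂ − n₁)·(μ₂ − μ₁) ≥ g` holds on the whole cell.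
[cite: Israel1979, Thm. I.2.4] [cite: Griffiths1966, §II] -/
theorem psGC_gap_above_column (t : ℝ) {s₁ s₂ U₂ U₃ n₁ n₂ a b c₀ c₁ g : ℝ} (hU₂ : 0 ≤ U₂) (hc₁ : 0 ≤ c₁)
    (hn₁ : 0 < n₁) (hn : n₁ < n₂) (hn₂ : n₂ < 2) (ha : 0 ≤ a) (hb : 0 ≤ b) (hab : a + b = 1) {L F₁ : ℝ → ℝ}
    (hC : ∀ s ∈ Icc s₁ s₂, ∀ U ∈ Icc U₂ U₃, energyDensityTT' t s U (a * n₁ + b * n₂) ≤ c₀ + c₁ * U)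
    (hL : ∀ s ∈ Icc s₁ s₂, L s ≤ energyDensityTT' t s U₂ n₂)
    (hF₁ : ∀ s ∈ Icc s₁ s₂, ∀ U ∈ Icc U₂ U₃, F₁ s ≤ energyDensityTT' t s U n₁)
    (hg : ∀ s ∈ Icc s₁ s₂, g ≤ a * F₁ s + b * L s - (c₀ + c₁ * U₃))
    {s : ℝ} (hs : s ∈ Icc s₁ s₂) {U : ℝ} (hU : U ∈ Icc U₂ U₃)
    {Γ₁ Γ₂ : FermionInteraction 2} {R₁ R₂ μ₁ μ₂ : ℝ} {ω₁ ω₂ : InfVolFermionState 2}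
    (hω₁ : ω₁.IsMeanEnergyMinimiser Γ₁ R₁)
    (hΓ₁ : ∀ σ : InfVolFermionState 2, σ.meanEnergy Γ₁ R₁ = σ.meanEnergy (hubbardTTPrimeFermionInteraction t s U) 1 - μ₁ * σ.density)
    (hω₂ : ω₂.IsMeanEnergyMinimiser Γ₂ R₂)
    (hΓ₂ : ∀ σ : InfVolFermionState 2, σ.meanEnergy Γ₂ R₂ = σ.meanEnergy (hubbardTTPrimeFermionInteraction t s U) 1 - μ₂ * σ.density)
    (hρ₁ : ω₁.density ≤ n₁) (hρ₂ : n₂ ≤ ω₂.density) :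
    g ≤ a * b * (n₂ - n₁) * (μ₂ - μ₁) := by
  refine psGC_gap_on_cell_of_fns t hU₂ hn₁ hn hn₂ ha hb hab (C := fun _ U => c₀ + c₁ * U) (F₁ := fun s _ => F₁ s)
    (F₂ := fun s _ => L s) hC hF₁ (fun s hs U hU => floor_above_column_of_law t (hn₁.le.trans hn.le) hn₂ hU₂ hL s hs U hU.1) ?_
    hs hU hω₁ hΓ₁ hω₂ hΓ₂ hρ₁ hρ₂
  intro s hs U hU
  have k := mul_le_mul_of_nonneg_left hU.2 hc₁
  have h := hg s hs
  show g ≤ a * F₁ s + b * L s - (c₀ + c₁ * U)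
  linarith

/-- **NO `μ` CARRIES BOTH PHASES, COLUMN FORM (`T = 0`).** Same inputs as `ps_not_groundState_mix_on_cell_of_columns` (cap affine in `U`,
two column laws, a floor function, both column margins POSITIVE); then at every `(s, U)` of the cell and every `μ`: if `H(t,s,U) − μN` has a
translation-invariant ground state of density `≤ n₁`, it has none of density `≥ n₂` — the grand-canonical density does not jump across
`[n₁, n₂]` anywhere on the cell. [cite: Israel1979, Thm. I.2.4] [cite: EmeryKivelsonLin1990, pp. 475–476] -/
theorem psGC_not_groundState_on_cell_of_columns (t : ℝ) {s₁ s₂ U₁ U₂ n₁ n₂ a b c₀ c₁ : ℝ} (hU₁ : 0 ≤ U₁) (h12 : U₁ < U₂)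
    (hn₁ : 0 < n₁) (hn : n₁ < n₂) (hn₂ : n₂ < 2) (ha : 0 ≤ a) (hb : 0 ≤ b) (hab : a + b = 1) {L₁ L₂ F₁ : ℝ → ℝ}
    (hC : ∀ s ∈ Icc s₁ s₂, ∀ U ∈ Icc U₁ U₂, energyDensityTT' t s U (a * n₁ + b * n₂) ≤ c₀ + c₁ * U)
    (hL₁ : ∀ s ∈ Icc s₁ s₂, L₁ s ≤ energyDensityTT' t s U₁ n₂) (hL₂ : ∀ s ∈ Icc s₁ s₂, L₂ s ≤ energyDensityTT' t s U₂ n₂)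
    (hF₁ : ∀ s ∈ Icc s₁ s₂, ∀ U ∈ Icc U₁ U₂, F₁ s ≤ energyDensityTT' t s U n₁)
    (hm₁ : ∀ s ∈ Icc s₁ s₂, c₀ + c₁ * U₁ < a * F₁ s + b * L₁ s) (hm₂ : ∀ s ∈ Icc s₁ s₂, c₀ + c₁ * U₂ < a * F₁ s + b * L₂ s)
    {s : ℝ} (hs : s ∈ Icc s₁ s₂) {U : ℝ} (hU : U ∈ Icc U₁ U₂)
    {Γ : FermionInteraction 2} {R' μ : ℝ} {ω₁ ω₂ : InfVolFermionState 2} (hω₁ : ω₁.IsMeanEnergyMinimiser Γ R')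
    (hΓ : ∀ σ : InfVolFermionState 2, σ.meanEnergy Γ R' = σ.meanEnergy (hubbardTTPrimeFermionInteraction t s U) 1 - μ * σ.density)
    (hρ₁ : ω₁.density ≤ n₁) (hρ₂ : n₂ ≤ ω₂.density) :
    ¬ ω₂.IsMeanEnergyMinimiser Γ R' := by
  intro hω₂
  have hpos := uchord_pos_of_ends h12 hU (sub_pos.2 (hm₁ s hs)) (sub_pos.2 (hm₂ s hs))
  have hid := margin_uchord_identity (a := a) (b := b) (c₀ := c₀) (c₁ := c₁) (U := U) (F := F₁ s) (L₁ := L₁ s) (L₂ := L₂ s) h12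
  rw [← hid] at hpos
  have h := margin_le_mul_sub_chemPot_of_groundStates_ttPrime t s (hU₁.trans hU.1) hω₁ hΓ hω₂ hΓ hn₁ hn₂ hρ₁ hn.le hρ₂ ha hb hab
    (hC s hs U hU) (hF₁ s hs U hU) (floor_on_cell_of_columnLaws t (hn₁.le.trans hn.le) hn₂ hU₁ h12 hL₁ hL₂ s hs U hU)
  rw [sub_self, mul_zero] at h
  linarith

/-- **NO `μ` CARRIES BOTH PHASES ABOVE A COLUMN (`T = 0`)**: inputs as `ps_not_groundState_mix_above_column` (cap with `c₁ ≥ 0`, one column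
law, a floor function, far-end margin positive). [cite: Israel1979, Thm. I.2.4] [cite: Griffiths1966, §II] -/
theorem psGC_not_groundState_above_column (t : ℝ) {s₁ s₂ U₂ U₃ n₁ n₂ a b c₀ c₁ : ℝ} (hU₂ : 0 ≤ U₂) (hc₁ : 0 ≤ c₁)
    (hn₁ : 0 < n₁) (hn : n₁ < n₂) (hn₂ : n₂ < 2) (ha : 0 ≤ a) (hb : 0 ≤ b) (hab : a + b = 1) {L F₁ : ℝ → ℝ}
    (hC : ∀ s ∈ Icc s₁ s₂, ∀ U ∈ Icc U₂ U₃, energyDensityTT' t s U (a * n₁ + b * n₂) ≤ c₀ + c₁ * U)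
    (hL : ∀ s ∈ Icc s₁ s₂, L s ≤ energyDensityTT' t s U₂ n₂)
    (hF₁ : ∀ s ∈ Icc s₁ s₂, ∀ U ∈ Icc U₂ U₃, F₁ s ≤ energyDensityTT' t s U n₁)
    (hm : ∀ s ∈ Icc s₁ s₂, c₀ + c₁ * U₃ < a * F₁ s + b * L s)
    {s : ℝ} (hs : s ∈ Icc s₁ s₂) {U : ℝ} (hU : U ∈ Icc U₂ U₃)
    {Γ : FermionInteraction 2} {R' μ : ℝ} {ω₁ ω₂ : InfVolFermionState 2} (hω₁ : ω₁.IsMeanEnergyMinimiser Γ R')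
    (hΓ : ∀ σ : InfVolFermionState 2, σ.meanEnergy Γ R' = σ.meanEnergy (hubbardTTPrimeFermionInteraction t s U) 1 - μ * σ.density)
    (hρ₁ : ω₁.density ≤ n₁) (hρ₂ : n₂ ≤ ω₂.density) :
    ¬ ω₂.IsMeanEnergyMinimiser Γ R' := by
  intro hω₂
  have h := margin_le_mul_sub_chemPot_of_groundStates_ttPrime t s (hU₂.trans hU.1) hω₁ hΓ hω₂ hΓ hn₁ hn₂ hρ₁ hn.le hρ₂ ha hb hab
    (hC s hs U hU) (hF₁ s hs U hU) (floor_above_column_of_law t (hn₁.le.trans hn.le) hn₂ hU₂ hL s hs U hU.1)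
  rw [sub_self, mul_zero] at h
  have k := mul_le_mul_of_nonneg_left hU.2 hc₁
  linarith [hm s hs]

/-! ## §2 `T > 0`: variational equilibria of `H(t, s, U) − μN` on a cell, hot anchors -/

/-- **NO `(β, μ)` CARRIES BOTH PHASES on a cell, from bound functions and HOT ANCHORS.** Hypotheses exactly as
`psT_not_thermal_mix_on_cell_of_fns_hotAnchor` (cap / floor functions on the ground-state energy density, cell-uniform pressure ceilings
`p(β_{h,i}; t,s,U; n_i) ≤ π_i` with `0 ≤ β_{h,i} ≤ β`, and `aπ₁ + bπ₂ + β_{h,1}aF₁ + β_{h,2}bF₂ < β(aF₁ + bF₂ − C)` on the cell), with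
`0 < n₁`. Then at every `(s, U)` of the cell and every `μ`: if `H(t,s,U) − μN` (any `Γ` with `e_Γ = e_Φ − μρ`) has a variational equilibrium at
`β` of density `≤ n₁`, it has none of density `≥ n₂`. [cite: Israel1979, Thm. I.2.4] [cite: PoulinHastings2011, eqs. (3)–(8)] -/
theorem psGCT_not_equilibrium_on_cell_of_fns_hotAnchor (t : ℝ) {s₁ s₂ U₁ U₂ n₁ n₂ a b β βh₁ βh₂ π₁ π₂ : ℝ} (hU₁ : 0 ≤ U₁)
    (hβ : 0 < β) (hn₁ : 0 < n₁) (hn : n₁ < n₂) (hn₂ : n₂ < 2) (ha : 0 ≤ a) (hb : 0 ≤ b) (hab : a + b = 1)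
    (hβh₁ : 0 ≤ βh₁) (hβh₂ : 0 ≤ βh₂) (hle₁ : βh₁ ≤ β) (hle₂ : βh₂ ≤ β) {C F₁ F₂ : ℝ → ℝ → ℝ}
    (hC : ∀ s ∈ Icc s₁ s₂, ∀ U ∈ Icc U₁ U₂, energyDensityTT' t s U (a * n₁ + b * n₂) ≤ C s U)
    (hF₁ : ∀ s ∈ Icc s₁ s₂, ∀ U ∈ Icc U₁ U₂, F₁ s U ≤ energyDensityTT' t s U n₁)
    (hF₂ : ∀ s ∈ Icc s₁ s₂, ∀ U ∈ Icc U₁ U₂, F₂ s U ≤ energyDensityTT' t s U n₂)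
    (hπ₁ : ∀ s ∈ Icc s₁ s₂, ∀ U ∈ Icc U₁ U₂, pressureTT' βh₁ t s U n₁ ≤ π₁)
    (hπ₂ : ∀ s ∈ Icc s₁ s₂, ∀ U ∈ Icc U₁ U₂, pressureTT' βh₂ t s U n₂ ≤ π₂)
    (hM : ∀ s ∈ Icc s₁ s₂, ∀ U ∈ Icc U₁ U₂,
      a * π₁ + b * π₂ + βh₁ * (a * F₁ s U) + βh₂ * (b * F₂ s U) < β * (a * F₁ s U + b * F₂ s U - C s U))
    {s : ℝ} (hs : s ∈ Icc s₁ s₂) {U : ℝ} (hU : U ∈ Icc U₁ U₂)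
    {Γ : FermionInteraction 2} {R' μ : ℝ} {ω₁ ω₂ : InfVolFermionState 2} (hω₁ : ω₁.IsVarEquilibrium β Γ R')
    (hΓ : ∀ σ : InfVolFermionState 2, σ.meanEnergy Γ R' = σ.meanEnergy (hubbardTTPrimeFermionInteraction t s U) 1 - μ * σ.density)
    (hρ₁ : ω₁.density ≤ n₁) (hρ₂ : n₂ ≤ ω₂.density) :
    ¬ ω₂.IsVarEquilibrium β Γ R' :=
  hω₁.not_isVarEquilibrium_of_le_of_le_hotAnchors_ttPrime t s (hU₁.trans hU.1) hβ hΓ hn₁ hn₂ hρ₁ hn.le hρ₂ ha hb hab (hC s hs U hU)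
    (hF₁ s hs U hU) (hF₂ s hs U hU) hβh₁ hβh₂ hle₁ hle₂ (hπ₁ s hs U hU) (hπ₂ s hs U hU) (hM s hs U hU)

/-- **NO `(β, μ)` CARRIES BOTH PHASES, COLUMN × THRESHOLD FORM (`T > 0`).** Hypotheses exactly as
`psT_not_thermal_mix_on_cell_of_columns_hotAnchor` (cap affine in `U`, two column laws at `n₂`, dilute floor `F₁`, cell-uniform anchors,
both column `T = 0` margins `≥ 0` and the anchored inequality at `β₀` on both columns, `β_{h,i} ≤ β₀ ≤ β`), with `0 < n₁`: at every `(s, U)`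
of the cell no variational equilibrium of `H(t,s,U) − μN` at `β` of density `≥ n₂` coexists with one of density `≤ n₁`.
[cite: Israel1979, Thm. I.2.4] [cite: PoulinHastings2011, eqs. (3)–(8)] [cite: Ruelle1969, §3.4] -/
theorem psGCT_not_equilibrium_on_cell_of_columns_hotAnchor (t : ℝ) {s₁ s₂ U₁ U₂ n₁ n₂ a b c₀ c₁ β β₀ βh₁ βh₂ π₁ π₂ : ℝ}
    (hU₁ : 0 ≤ U₁) (h12 : U₁ < U₂) (hn₁ : 0 < n₁) (hn : n₁ < n₂) (hn₂ : n₂ < 2) (ha : 0 ≤ a) (hb : 0 ≤ b)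
    (hab : a + b = 1) (hβh₁ : 0 ≤ βh₁) (hβh₂ : 0 ≤ βh₂) (h0₁ : βh₁ ≤ β₀) (h0₂ : βh₂ ≤ β₀) (hβ₀ : β₀ ≤ β)
    (hβ₀pos : 0 < β₀) {L₁ L₂ F₁ : ℝ → ℝ}
    (hC : ∀ s ∈ Icc s₁ s₂, ∀ U ∈ Icc U₁ U₂, energyDensityTT' t s U (a * n₁ + b * n₂) ≤ c₀ + c₁ * U)
    (hL₁ : ∀ s ∈ Icc s₁ s₂, L₁ s ≤ energyDensityTT' t s U₁ n₂) (hL₂ : ∀ s ∈ Icc s₁ s₂, L₂ s ≤ energyDensityTT' t s U₂ n₂)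
    (hF₁ : ∀ s ∈ Icc s₁ s₂, ∀ U ∈ Icc U₁ U₂, F₁ s ≤ energyDensityTT' t s U n₁)
    (hπ₁ : ∀ s ∈ Icc s₁ s₂, ∀ U ∈ Icc U₁ U₂, pressureTT' βh₁ t s U n₁ ≤ π₁)
    (hπ₂ : ∀ s ∈ Icc s₁ s₂, ∀ U ∈ Icc U₁ U₂, pressureTT' βh₂ t s U n₂ ≤ π₂)
    (hm₁ : ∀ s ∈ Icc s₁ s₂, 0 ≤ a * F₁ s + b * L₁ s - (c₀ + c₁ * U₁))
    (hm₂ : ∀ s ∈ Icc s₁ s₂, 0 ≤ a * F₁ s + b * L₂ s - (c₀ + c₁ * U₂))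
    (hg₁ : ∀ s ∈ Icc s₁ s₂,
      a * π₁ + b * π₂ + βh₁ * (a * F₁ s) + βh₂ * (b * L₁ s) < β₀ * (a * F₁ s + b * L₁ s - (c₀ + c₁ * U₁)))
    (hg₂ : ∀ s ∈ Icc s₁ s₂,
      a * π₁ + b * π₂ + βh₁ * (a * F₁ s) + βh₂ * (b * L₂ s) < β₀ * (a * F₁ s + b * L₂ s - (c₀ + c₁ * U₂)))
    {s : ℝ} (hs : s ∈ Icc s₁ s₂) {U : ℝ} (hU : U ∈ Icc U₁ U₂)
    {Γ : FermionInteraction 2} {R' μ : ℝ} {ω₁ ω₂ : InfVolFermionState 2} (hω₁ : ω₁.IsVarEquilibrium β Γ R')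
    (hΓ : ∀ σ : InfVolFermionState 2, σ.meanEnergy Γ R' = σ.meanEnergy (hubbardTTPrimeFermionInteraction t s U) 1 - μ * σ.density)
    (hρ₁ : ω₁.density ≤ n₁) (hρ₂ : n₂ ≤ ω₂.density) :
    ¬ ω₂.IsVarEquilibrium β Γ R' := by
  have hn2' : 0 ≤ n₂ := hn₁.le.trans hn.le
  have hβ0pos : 0 < β := hβ₀pos.trans_le hβ₀
  refine psGCT_not_equilibrium_on_cell_of_fns_hotAnchor t hU₁ hβ0pos hn₁ hn hn₂ ha hb hab hβh₁ hβh₂ (h0₁.trans hβ₀)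
    (h0₂.trans hβ₀) (C := fun _ U => c₀ + c₁ * U) (F₁ := fun s _ => F₁ s)
    (F₂ := fun s U => ((U₂ - U) * L₁ s + (U - U₁) * L₂ s) / (U₂ - U₁)) hC hF₁
    (floor_on_cell_of_columnLaws t hn2' hn₂ hU₁ h12 hL₁ hL₂) hπ₁ hπ₂ ?_ hs hU hω₁ hΓ hρ₁ hρ₂
  intro s hs U hU
  -- the anchored slack at `β₀` is the `U`-chord of the column slacks; the `T = 0` margin is `≥ 0`, so `β·M ≥ β₀·M`
  have e₁ : a * π₁ + b * π₂ <
      β₀ * (a * F₁ s + b * L₁ s - (c₀ + c₁ * U₁)) - (βh₁ * (a * F₁ s) + βh₂ * (b * L₁ s)) := by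
    have := hg₁ s hs; linarith
  have e₂ : a * π₁ + b * π₂ <
      β₀ * (a * F₁ s + b * L₂ s - (c₀ + c₁ * U₂)) - (βh₁ * (a * F₁ s) + βh₂ * (b * L₂ s)) := by
    have := hg₂ s hs; linarith
  have hchord := chord_gt_of_ends_gt h12 hU e₁ e₂
  have hd : (U₂ - U₁) ≠ 0 := (sub_pos.2 h12).ne'
  have hid : β₀ * (a * F₁ s + b * (((U₂ - U) * L₁ s + (U - U₁) * L₂ s) / (U₂ - U₁)) - (c₀ + c₁ * U)) -
        (βh₁ * (a * F₁ s) + βh₂ * (b * (((U₂ - U) * L₁ s + (U - U₁) * L₂ s) / (U₂ - U₁)))) =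
      ((U₂ - U) * (β₀ * (a * F₁ s + b * L₁ s - (c₀ + c₁ * U₁)) - (βh₁ * (a * F₁ s) + βh₂ * (b * L₁ s))) +
        (U - U₁) * (β₀ * (a * F₁ s + b * L₂ s - (c₀ + c₁ * U₂)) - (βh₁ * (a * F₁ s) + βh₂ * (b * L₂ s)))) /
        (U₂ - U₁) := by
    field_simp
    ring
  rw [← hid] at hchord
  have hge := chord_ge_of_ends_ge h12 hU (hm₁ s hs) (hm₂ s hs)
  have hidM := margin_uchord_identity (a := a) (b := b) (c₀ := c₀) (c₁ := c₁) (U := U) (F := F₁ s) (L₁ := L₁ s) (L₂ := L₂ s) h12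
  have hM : 0 ≤ a * F₁ s + b * (((U₂ - U) * L₁ s + (U - U₁) * L₂ s) / (U₂ - U₁)) - (c₀ + c₁ * U) := hidM ▸ hge
  have k := mul_le_mul_of_nonneg_right hβ₀ hM
  show a * π₁ + b * π₂ + βh₁ * (a * F₁ s) + βh₂ * (b * (((U₂ - U) * L₁ s + (U - U₁) * L₂ s) / (U₂ - U₁))) <
    β * (a * F₁ s + b * (((U₂ - U) * L₁ s + (U - U₁) * L₂ s) / (U₂ - U₁)) - (c₀ + c₁ * U))
  linarith

/-- **NO `(β, μ)` CARRIES BOTH PHASES ABOVE A COLUMN (`T > 0`, threshold form).** Hypotheses exactly as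
`psT_not_thermal_mix_above_column_hotAnchor` (cap with `c₁ ≥ 0`, one column law, dilute floor, cell-uniform anchors, far-end `T = 0` margin
`≥ 0` and the anchored inequality at `(β₀, U₃)`), with `0 < n₁`. [cite: Israel1979, Thm. I.2.4] [cite: Griffiths1966, §II]
[cite: PoulinHastings2011, eqs. (3)–(8)] -/
theorem psGCT_not_equilibrium_above_column_hotAnchor (t : ℝ) {s₁ s₂ U₂ U₃ n₁ n₂ a b c₀ c₁ β β₀ βh₁ βh₂ π₁ π₂ : ℝ}
    (hU₂ : 0 ≤ U₂) (hc₁ : 0 ≤ c₁) (hn₁ : 0 < n₁) (hn : n₁ < n₂) (hn₂ : n₂ < 2) (ha : 0 ≤ a) (hb : 0 ≤ b)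
    (hab : a + b = 1) (hβh₁ : 0 ≤ βh₁) (hβh₂ : 0 ≤ βh₂) (h0₁ : βh₁ ≤ β₀) (h0₂ : βh₂ ≤ β₀) (hβ₀ : β₀ ≤ β) (hβ₀pos : 0 < β₀)
    {L F₁ : ℝ → ℝ}
    (hC : ∀ s ∈ Icc s₁ s₂, ∀ U ∈ Icc U₂ U₃, energyDensityTT' t s U (a * n₁ + b * n₂) ≤ c₀ + c₁ * U)
    (hL : ∀ s ∈ Icc s₁ s₂, L s ≤ energyDensityTT' t s U₂ n₂)
    (hF₁ : ∀ s ∈ Icc s₁ s₂, ∀ U ∈ Icc U₂ U₃, F₁ s ≤ energyDensityTT' t s U n₁)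
    (hπ₁ : ∀ s ∈ Icc s₁ s₂, ∀ U ∈ Icc U₂ U₃, pressureTT' βh₁ t s U n₁ ≤ π₁)
    (hπ₂ : ∀ s ∈ Icc s₁ s₂, ∀ U ∈ Icc U₂ U₃, pressureTT' βh₂ t s U n₂ ≤ π₂)
    (hm : ∀ s ∈ Icc s₁ s₂, 0 ≤ a * F₁ s + b * L s - (c₀ + c₁ * U₃))
    (hg : ∀ s ∈ Icc s₁ s₂,
      a * π₁ + b * π₂ + βh₁ * (a * F₁ s) + βh₂ * (b * L s) < β₀ * (a * F₁ s + b * L s - (c₀ + c₁ * U₃)))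
    {s : ℝ} (hs : s ∈ Icc s₁ s₂) {U : ℝ} (hU : U ∈ Icc U₂ U₃)
    {Γ : FermionInteraction 2} {R' μ : ℝ} {ω₁ ω₂ : InfVolFermionState 2} (hω₁ : ω₁.IsVarEquilibrium β Γ R')
    (hΓ : ∀ σ : InfVolFermionState 2, σ.meanEnergy Γ R' = σ.meanEnergy (hubbardTTPrimeFermionInteraction t s U) 1 - μ * σ.density)
    (hρ₁ : ω₁.density ≤ n₁) (hρ₂ : n₂ ≤ ω₂.density) :
    ¬ ω₂.IsVarEquilibrium β Γ R' := by
  have hn2' : 0 ≤ n₂ := hn₁.le.trans hn.le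
  refine psGCT_not_equilibrium_on_cell_of_fns_hotAnchor t hU₂ (hβ₀pos.trans_le hβ₀) hn₁ hn hn₂ ha hb hab hβh₁ hβh₂
    (h0₁.trans hβ₀) (h0₂.trans hβ₀) (C := fun _ U => c₀ + c₁ * U) (F₁ := fun s _ => F₁ s) (F₂ := fun s _ => L s) hC hF₁
    (fun s hs U hU => floor_above_column_of_law t hn2' hn₂ hU₂ hL s hs U hU.1) hπ₁ hπ₂ ?_ hs hU hω₁ hΓ hρ₁ hρ₂
  intro s hs U hU
  have k := mul_le_mul_of_nonneg_left hU.2 hc₁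
  have hM3 := hm s hs
  have hM : a * F₁ s + b * L s - (c₀ + c₁ * U₃) ≤ a * F₁ s + b * L s - (c₀ + c₁ * U) := by linarith
  have hMU : 0 ≤ a * F₁ s + b * L s - (c₀ + c₁ * U) := hM3.trans hM
  have k1 := mul_le_mul_of_nonneg_left hM hβ₀pos.le
  have k2 := mul_le_mul_of_nonneg_right hβ₀ hMU
  have hg' := hg s hs
  show a * π₁ + b * π₂ + βh₁ * (a * F₁ s) + βh₂ * (b * L s) < β * (a * F₁ s + b * L s - (c₀ + c₁ * U))
  linarith

end Summit.Ventures.CertifiedManyBodySolver.Observables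

end
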